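import Literature.Analysis.Calculus.MvPolynomialFDeriv
import Mathlib.Algebra.MvPolynomial.Funext
import HarnessLib

/-!
# The polynomial Laplacian: `Δ(ρ h)` and the eigenvalue recursion

Analysis/algebra support file (everything proved; two small definitions, no named facts) for the
spherical-harmonics route to the sharp Poincaré inequality on spheres (A. Waldron, Invent. math.
217 (2019), Lemma 3.5: "the first eigenvalue … on functions is 3"). On `MvPolynomial (Fin n) ℝ`:

* `lap p = ∑ₖ ∂ₖ∂ₖ p`, `rho = ∑ₖ Xₖ²`; `isHomogeneous_lap`, `isHomogeneous_rho`;
* `lap_rho_mul` — for `h` homogeneous of degree `d`: `Δ(ρ h) = (2n + 4d) h + ρ Δh`;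
* `eigenvalue_recursion` — if `ρ Δq = c q` for `q` homogeneous of degree `d`, then
  `ρ Δ(Δq) = (c − 2n − 4(d−2)) Δq` (`d ≥ 2`);
* `eigenvalue_of_rho_lap_eq_smul` — **the spectrum**: if `p ≠ 0` is homogeneous of degree `K`
  and `ρ Δp = c₀ p`, then `c₀ = K(K+n−2) − k(k+n−2)` for some `k ≤ K`; in the application
  (`c₀ = K(K+n−2) − λ` from `T(p|_S) = −λ p|_S`) this is `λ = k(k+n−2)`, so `λ = 0 ∨ λ ≥ n − 1`.

References: (spherical harmonics, Fischer decomposition) [folklore]; A. Waldron, Invent. math.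
217 (2019), Lemma 3.5 [Waldron2019].
-/

noncomputable section

open scoped BigOperators
open MvPolynomial

namespace Literature.Analysis.Calculus

namespace MvPoly

variable {n : ℕ}

/-- The polynomial Laplacian `Δp = ∑ₖ ∂ₖ∂ₖ p`. [folklore] -/
def lap (p : MvPolynomial (Fin n) ℝ) : MvPolynomial (Fin n) ℝ :=
  ∑ k, pderiv k (pderiv k p)

/-- The squared radius `ρ = ∑ₖ Xₖ²`. [folklore] -/
def rho : MvPolynomial (Fin n) ℝ := ∑ k, X k ^ 2

/-- `Δ` is linear. [folklore] -/
theorem lap_add (p q : MvPolynomial (Fin n) ℝ) : lap (p + q) = lap p + lap q := by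
  simp [lap, map_add, Finset.sum_add_distrib]

/-- `Δ` is linear. [folklore] -/
theorem lap_smul (a : ℝ) (p : MvPolynomial (Fin n) ℝ) : lap (a • p) = a • lap p := by
  simp [lap, Finset.smul_sum]

/-- `Δ 0 = 0`. [folklore] -/
@[simp] theorem lap_zero : lap (0 : MvPolynomial (Fin n) ℝ) = 0 := by simp [lap]

/-- The Laplacian of a homogeneous polynomial of degree `d` is homogeneous of degree `d − 2`.
[folklore] -/
theorem isHomogeneous_lap {p : MvPolynomial (Fin n) ℝ} {d : ℕ} (hp : p.IsHomogeneous d) :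
    (lap p).IsHomogeneous (d - 2) := by
  unfold lap
  refine IsHomogeneous.sum _ _ _ fun k _ => ?_
  have h := (hp.pderiv (i := k)).pderiv (i := k)
  rwa [show d - 1 - 1 = d - 2 by omega] at h

/-- `ρ` is homogeneous of degree `2`. [folklore] -/
theorem isHomogeneous_rho : (rho : MvPolynomial (Fin n) ℝ).IsHomogeneous 2 := by
  unfold rho
  refine IsHomogeneous.sum _ _ _ fun k _ => ?_
  simpa using (isHomogeneous_X ℝ k).pow 2

/-- `∂ₖ ρ = 2 Xₖ`. [folklore] -/
theorem pderiv_rho (k : Fin n) : pderiv k (rho : MvPolynomial (Fin n) ℝ) = 2 * X k := by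
  unfold rho
  rw [map_sum, Finset.sum_eq_single k]
  · rw [pderiv_pow, pderiv_X_self]; simp
  · intro j _ hjk
    rw [pderiv_pow, pderiv_X_of_ne hjk]; simp
  · simp

/-- **The Laplacian of `ρ h`** for `h` homogeneous of degree `d`:
`Δ(ρ h) = (2n + 4d) h + ρ Δh` (Euler's identity `∑ₖ Xₖ ∂ₖ h = d h`). [folklore] -/
theorem lap_rho_mul {h : MvPolynomial (Fin n) ℝ} {d : ℕ} (hh : h.IsHomogeneous d) :
    lap (rho * h) = (2 * (n : MvPolynomial (Fin n) ℝ) + 4 * (d : MvPolynomial (Fin n) ℝ)) * h +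
      rho * lap h := by
  have hE : ∑ k : Fin n, X k * pderiv k h = d • h := hh.sum_X_mul_pderiv
  have hterm : ∀ k, pderiv k (pderiv k (rho * h)) =
      2 * h + 4 * (X k * pderiv k h) + rho * pderiv k (pderiv k h) := by
    intro k
    have e1 : pderiv k (rho * h) = C 2 * (X k * h) + rho * pderiv k h := by
      rw [pderiv_mul, pderiv_rho, show (2 : MvPolynomial (Fin n) ℝ) = C 2 from
        (map_ofNat C 2).symm]; ring
    have e2 : pderiv k (X k * h) = h + X k * pderiv k h := by
      rw [pderiv_mul, pderiv_X_self]; ring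
    have e3 : pderiv k (rho * pderiv k h) = 2 * (X k * pderiv k h) + rho * pderiv k (pderiv k h) := by
      rw [pderiv_mul, pderiv_rho]; ring
    rw [e1, map_add, pderiv_C_mul, e2, e3, show (C 2 : MvPolynomial (Fin n) ℝ) = 2 from
      map_ofNat C 2]
    ring
  unfold lap
  simp_rw [hterm, Finset.sum_add_distrib, ← Finset.mul_sum, hE]
  simp only [Finset.sum_const, Finset.card_univ, Fintype.card_fin, nsmul_eq_mul]
  ring

/-- Iterated Laplacians of a homogeneous polynomial. [folklore] -/
theorem isHomogeneous_lap_iterate {p : MvPolynomial (Fin n) ℝ} {K : ℕ} (hp : p.IsHomogeneous K)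
    (j : ℕ) : (lap^[j] p).IsHomogeneous (K - 2 * j) := by
  induction j with
  | zero => simpa using hp
  | succ j ih =>
    rw [Function.iterate_succ_apply']
    have h := isHomogeneous_lap ih
    rwa [show K - 2 * j - 2 = K - 2 * (j + 1) by omega] at h

/-- A homogeneous polynomial of degree `≤ 1` has zero Laplacian. [folklore] -/
theorem lap_eq_zero_of_isHomogeneous_le_one {q : MvPolynomial (Fin n) ℝ} {d : ℕ}
    (hq : q.IsHomogeneous d) (hd : d ≤ 1) : lap q = 0 := by
  -- `∂ₖ∂ₖ q` is homogeneous of degree `d - 2 = 0`... we argue via total degree instead: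
  -- `∂ₖ q` is homogeneous of degree `d - 1 = 0`, hence a constant, hence `∂ₖ∂ₖ q = 0`.
  unfold lap
  refine Finset.sum_eq_zero fun k _ => ?_
  have h1 : (pderiv k q).IsHomogeneous (d - 1) := hq.pderiv
  have h0 : (pderiv k q).IsHomogeneous 0 := by rwa [show d - 1 = 0 by omega] at h1
  rw [← totalDegree_zero_iff_isHomogeneous, totalDegree_eq_zero_iff_eq_C] at h0
  rw [h0, pderiv_C]

/-- Beyond half the degree, the iterated Laplacians vanish. [folklore] -/
theorem lap_iterate_eq_zero {p : MvPolynomial (Fin n) ℝ} {K : ℕ} (hp : p.IsHomogeneous K)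
    {j : ℕ} (hj : K < 2 * j) : lap^[j] p = 0 := by
  obtain ⟨j, rfl⟩ : ∃ i, j = i + 1 := ⟨j - 1, by omega⟩
  rw [Function.iterate_succ_apply']
  exact lap_eq_zero_of_isHomogeneous_le_one (isHomogeneous_lap_iterate hp j) (by omega)

/-- **One step of the eigenvalue recursion**: if `ρ Δq = c q` with `q` homogeneous of degree
`d ≥ 2`, then `ρ Δ(Δq) = (c − 2n − 4(d − 2)) Δq`. [folklore] -/
theorem eigenvalue_recursion {q : MvPolynomial (Fin n) ℝ} {d : ℕ} (hq : q.IsHomogeneous d)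
    {c : ℝ} (h : rho * lap q = C c * q) :
    rho * lap (lap q) = C (c - 2 * n - 4 * (d - 2 : ℕ)) * lap q := by
  have hl : (lap q).IsHomogeneous (d - 2) := isHomogeneous_lap hq
  -- apply `Δ` to `ρ Δq = c q`
  have h1 := congrArg lap h
  rw [lap_rho_mul hl, show C c * q = c • q from (smul_eq_C_mul q c).symm, lap_smul,
    smul_eq_C_mul] at h1
  -- rearrange
  have h2 : rho * lap (lap q) =
      C c * lap q - (2 * (n : MvPolynomial (Fin n) ℝ) + 4 * ((d - 2 : ℕ) : MvPolynomial (Fin n) ℝ)) *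
        lap q := by
    rw [← h1]; ring
  rw [h2, map_sub, map_sub, map_mul, map_mul, map_natCast, map_natCast]
  simp only [map_ofNat]
  ring

/-- The closed form of the recursion coefficients: starting from `c₀` at degree `K`, after `j`
steps (degrees `K, K−2, …, K−2j`, all `≥ 0`) the coefficient is
`c_j = c₀ − j(2n + 4K + 4) + 4j(j + ... )`; precisely `c_j = c₀ − (2n·j + 4K·j − 4j² − 4j)`.
[folklore] -/
theorem rho_mul_lap_iterate {p : MvPolynomial (Fin n) ℝ} {K : ℕ} (hp : p.IsHomogeneous K)
    {c₀ : ℝ} (h0 : rho * lap p = C c₀ * p) :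
    ∀ j : ℕ, 2 * j ≤ K →
      rho * lap (lap^[j] p) =
        C (c₀ - (2 * n * j + 4 * K * j - 4 * j ^ 2 - 4 * j)) * lap^[j] p := by
  intro j
  induction j with
  | zero => intro _; simpa using h0
  | succ j ih =>
    intro hj
    have hj' : 2 * j ≤ K := by omega
    have hrec := eigenvalue_recursion (isHomogeneous_lap_iterate hp j) (ih hj')
    rw [Function.iterate_succ_apply']
    rw [hrec]
    congr 2
    have hcast : ((K - 2 * j - 2 : ℕ) : ℝ) = (K : ℝ) - 2 * j - 2 := by
      rw [Nat.cast_sub (by omega), Nat.cast_sub (by omega)]; push_cast; ring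
    rw [hcast]; push_cast; ring

/-- **The spectrum of the spherical Laplacian on homogeneous polynomials (algebraic form).**
If `p ≠ 0` is homogeneous of degree `K` and `ρ Δp = c₀ p`, then
`c₀ = K(K+n−2) − k(k+n−2)` for some `k ≤ K` (with `K − k` even): letting `j₀` be maximal with
`Δ^{j₀} p ≠ 0`, the recursion gives `c_{j₀} = 0`, and `k = K − 2j₀`. [folklore] -/
theorem eigenvalue_of_rho_lap_eq_smul {p : MvPolynomial (Fin n) ℝ} {K : ℕ} (hp : p.IsHomogeneous K)
    (hp0 : p ≠ 0) {c₀ : ℝ} (h0 : rho * lap p = C c₀ * p) :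
    ∃ k : ℕ, k ≤ K ∧ c₀ = (K : ℝ) * (K + n - 2) - k * (k + n - 2) := by
  classical
  -- the last index with a nonvanishing iterated Laplacian
  have hfin : ∃ j, lap^[j] p ≠ 0 ∧ lap^[j + 1] p = 0 := by
    by_contra hcon
    simp only [not_exists, not_and] at hcon
    have hall : ∀ j, lap^[j] p ≠ 0 := by
      intro j
      induction j with
      | zero => simpa using hp0
      | succ j ih => exact hcon j ih
    exact hall (K + 1) (lap_iterate_eq_zero hp (by omega))
  obtain ⟨j₀, hj₀, hj₁⟩ := hfin
  have h2j : 2 * j₀ ≤ K := by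
    by_contra hlt
    exact hj₀ (lap_iterate_eq_zero hp (by omega))
  have hrec := rho_mul_lap_iterate hp h0 j₀ h2j
  rw [Function.iterate_succ_apply'] at hj₁
  rw [hj₁, mul_zero] at hrec
  -- `0 = C c_{j₀} * Δ^{j₀} p` with `Δ^{j₀} p ≠ 0` forces `c_{j₀} = 0`
  have hc : c₀ - (2 * n * j₀ + 4 * K * j₀ - 4 * j₀ ^ 2 - 4 * j₀) = 0 := by
    by_contra hne
    apply hj₀
    have := congrArg (fun q => C (c₀ - (2 * n * j₀ + 4 * K * j₀ - 4 * j₀ ^ 2 - 4 * j₀))⁻¹ * q) hrec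
    simp only [mul_zero, ← mul_assoc, ← map_mul, inv_mul_cancel₀ hne, map_one, one_mul] at this
    exact this.symm
  refine ⟨K - 2 * j₀, by omega, ?_⟩
  rw [Nat.cast_sub h2j]
  push_cast
  linarith

end MvPoly



end Literature.Analysis.Calculus
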